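import Literature.Analysis.FluidPDE.NSSuitableESS
import Literature.Analysis.FluidPDE.RieszPressureSpaceTimeLp
import Literature.Analysis.FluidPDE.VeryWeakToDistributional
import HarnessLib

/-!
# The associated pressure of an `L_{3,∞}` Leray–Hopf solution: discharge of `ess_associated_pressure`

Analysis/FluidPDE proof file (theorems only), sibling of `NSSuitableESS.lean`, whose named fact
`Literature.Analysis.FluidPDE.ess_associated_pressure` (Escauriaza–Seregin–Šverák 2003, §3, proof
of Thm. 1.3, (3.2)–(3.4): "Using known Ladyzhenskaya's arguments, involving the coercive estimates
and the uniqueness theorem for Stokes problem, we can introduce the so-called associated pressure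
`p` [...]. The pair `v` and `p` satisfies the Navier–Stokes equations a.e. in `Q_T`. Moreover, by
the pressure equation (3.3) `Δp = -div div v ⊗ v`, we have (3.4) `p ∈ L_{3/2,∞}(Q_T)`") is PROVED
here (`ess_associated_pressure_holds`): for `ν > 0`, `T > 0`, a square-integrable weakly
divergence-free datum, a Leray–Hopf weak solution `u` of the unforced Cauchy problem on
`ℝ³ × [0, T)` with `u ∈ L^∞(0, T; L³)` (guarded `MemLqLp ∞ 3`), there is a pressure
`p ∈ L^∞(0, T; L^{3/2})` such that `(u, p)` solves the Navier–Stokes equations in the sense of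
distributions on the open strip `(0, T) × ℝ³` (`IsDistributionalNSSolutionOn` on `Fluid.slab`).

## The proof

The pressure is the Riesz pressure `p(t) = Σᵢⱼ ℛᵢℛⱼ(uᵢuⱼ)(t)` of the slices — the solution of
the pressure equation (3.3) in `L^{3/2}(ℝ³)`, which is how "Ladyzhenskaya's arguments" produce it
in the whole space (Lemarié-Rieusset 2016, Prop. 6.5 with Def. 6.9: a very weak solution in
`L²_t L²((1+|x|)⁻⁴dx) ⊃ L^∞_t L³_x` is an Oseen solution, `∇p = -(Id - ℙ) div(u ⊗ u)`,
`p = Σ ℛᵢℛⱼ(uᵢuⱼ)`). All the analysis is in the tree: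

* the slice operator `Π = rieszPressure : L³ → L^{3/2}` with Stein's bound
  `‖Π[w]‖_{3/2} ≤ C_{3/2} ‖w‖₃²` and the weak Poisson equation (`RieszPressureL3.lean`, from the
  proved Calderón–Zygmund bound `stein1970_normalisedPressure_Lp_bound_holds`);
* its jointly measurable space–time representative for a velocity in `L³((0,T) × ℝ³)` without
  time regularity (`exists_spaceTime_rieszPressure_of_memLp`, `RieszPressureSpaceTimeLp.lean`) —
  this gives (3.4), `p ∈ L_{3/2,∞}(Q_T)`, from `u ∈ L_{3,∞}(Q_T)`;
* the passage from the very weak (divergence-free tested) equations with the Riesz pressure to the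
  pressure-explicit distributional system (`isDistributionalNSSolutionOn_slab_of_veryWeak`,
  `VeryWeakToDistributional.lean`; the compactly supported Helmholtz splitting of the test field).

This file supplies the bookkeeping from the Leray–Hopf class: `u ∈ L³` of the slab
(`memLp_uncurry_slab_of_memLqLp_top`: `∫₀ᵀ ‖u‖₃³ ≤ T ‖u‖³_{L^∞L³}`), the divergence constraint
and the very weak momentum equation in the `∫∫_{(0,T)×ℝ³}` form of `IsDistributionalNSSolutionOn`
(from the sliced `div u(t) = 0` and the Leray weak formulation `IsWeakNSSolutionOn` — test fields
on the open slab have no datum term — by Fubini), the space–time weak Poisson equation from the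
slice identities (Fubini), and the guarded mixed class `MemLqLp ∞ (3/2) p` from the slice bounds.

## Mathlib / tree search

Tree (all used): `ess_associated_pressure`, `IsLerayHopfOn`, `IsWeakNSSolutionOn`, `MemLqLp`,
`eLqLpNorm` (`NSSuitableESS`, `LerayHopf`, `WeakSolution`); `exists_spaceTime_rieszPressure_of_memLp`,
`volume_restrict_slab_eq_prod₃`, `lintegral_enorm_rpow_three_eq_eLpNorm_rpow`
(`RieszPressureSpaceTimeLp`); `isDistributionalNSSolutionOn_slab_of_veryWeak`,
`locallyIntegrableOn_slab_of_memLp`, `memLp_norm_sq_of_memLp_three`, `integrable_veryWeak_terms`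
(`VeryWeakToDistributional`); `integrable_inner_of_locallyIntegrableOn`,
`integrable_mul_of_locallyIntegrableOn`, `IsSpaceTimeTestOn.continuous_gradient_field`
(`SuitableWeakPressure`); `IsSpaceTimeTestOn.laplacian_isSpaceTimeTestOn`,
`laplacian_slice_eq_zero_of_notMem_tsupport` (`DistributionalPressurePoisson`);
`IsSpaceTimeTestOn.fderiv_slice_eq_zero_of_notMem` (`HeatDuhamelBack`; the tree also has the applied
`fderiv_fderiv_slice_eq_zero_of_notMem_tsupport`, `CKNPressureDuality`, not imported),
`IsSmoothSpaceTimeOn.isSmoothSpaceTimeOn_fderiv_of_isOpen` (`SpaceTimeCalculus`),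
`IsSpaceTimeTestOn.hasCompactSupport_slice`, `.contDiff_slice` (`ClassicalSolutionCalculus`,
`WeakSolution`). `lean search 'ess_associated_pressure_holds'`: absent. Mathlib: `integral_prod`,
`ae_le_eLpNormEssSup`, `eLpNormEssSup_lt_top_of_ae_bound`, `ae_restrict_iff'`,
`setIntegral_eq_integral_of_forall_compl_eq_zero`, `isBoundedBilinearMap_apply`.

## References

* L. Escauriaza, G. Seregin, V. Šverák, *`L_{3,∞}`-solutions of Navier–Stokes equations and
  backward uniqueness*, Russ. Math. Surveys 58:2 (2003) 211–250, §3, proof of Thm. 1.3,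
  (3.2)–(3.4). [EscauriazaSereginSverak2003]
* P. G. Lemarié-Rieusset, *The Navier–Stokes Problem in the 21st Century*, CRC Press 2016,
  Def. 6.2, Lemma 6.3, (6.13), Prop. 6.5 with Def. 6.9, Prop. 6.2. [LemarieRieusset2016]
* E. M. Stein, *Singular integrals and differentiability properties of functions* (1970), Ch. II
  §4.2 Thm. 3. [Stein1971]
* O. A. Ladyzhenskaya, *The mathematical theory of viscous incompressible flow*, 2nd ed. (1969),
  Ch. 1 §2 (the Stokes/pressure problem in the whole space). [Ladyzhenskaya1969]
-/

noncomputable section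

open MeasureTheory TopologicalSpace Set Function Filter Topology Metric InnerProductSpace
open scoped ENNReal NNReal RealInnerProductSpace Laplacian

namespace Literature.Analysis.FluidPDE

/-- Local notation for physical space `ℝ³ = EuclideanSpace ℝ (Fin 3)`. -/
local notation "ℝ³" => EuclideanSpace ℝ (Fin 3)

/-! ### From `L^∞(0,T; L³)` to `L³` of the slab -/

section SlabClass

variable {X : Type*} [MeasureSpace X] {F : Type*} [NormedAddCommGroup F]

/-- **An `L^∞_t L^p_x` field has a.e. bounded slice norms**: if `u ∈ L^∞(S; L^p)` (guarded
`MemLqLp ∞ p u S`) then `‖u(t)‖_{L^p} ≤ M` for a.e. `t ∈ S`, with `M = ‖u‖_{L^∞(S; L^p)}`.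
[folklore] -/
theorem MemLqLp.exists_ae_eLpNorm_le_of_top {p : ℝ≥0∞} {u : ℝ → X → F} {S : Set ℝ}
    (h : MemLqLp ∞ p u S) :
    ∃ M : ℝ≥0, ∀ᵐ t ∂(volume.restrict S), eLpNorm (u t) p volume ≤ M := by
  obtain ⟨hae, hfin⟩ := h
  rw [eLqLpNorm_def, eLpNorm_exponent_top] at hfin
  set M : ℝ≥0∞ := eLpNormEssSup (fun t => (eLpNorm (u t) p volume).toReal) (volume.restrict S)
    with hM
  refine ⟨M.toNNReal, ?_⟩
  filter_upwards [hae, ae_le_eLpNormEssSup (μ := volume.restrict S)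
    (f := fun t => (eLpNorm (u t) p volume).toReal)] with t ht hle
  rw [ENNReal.coe_toNNReal hfin.ne]
  calc eLpNorm (u t) p volume = ENNReal.ofReal (eLpNorm (u t) p volume).toReal :=
        (ENNReal.ofReal_toReal ht.eLpNorm_ne_top).symm
    _ = ‖(eLpNorm (u t) p volume).toReal‖ₑ := (Real.enorm_eq_ofReal ENNReal.toReal_nonneg).symm
    _ ≤ M := hle

variable {T : ℝ} {u : ℝ → ℝ³ → ℝ³}

/-- **`L^∞(0,T; L³) ⊂ L³((0,T) × ℝ³)`** for jointly measurable fields: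
`∫₀ᵀ ∫ |u|³ = ∫₀ᵀ ‖u(t)‖₃³ dt ≤ T M³` (Tonelli; Escauriaza–Seregin–Šverák 2003, §3: "since
`|div v ⊗ v| ∈ L_{4/3}(Q_T)`" rests on exactly this kind of passage from mixed to space–time
classes). [cite: EscauriazaSereginSverak2003, §3 (3.2)] -/
theorem memLp_uncurry_slab_of_memLqLp_top
    (hm : AEStronglyMeasurable (uncurry u) (volume.restrict (Ioo 0 T ×ˢ (univ : Set ℝ³))))
    (h3 : MemLqLp ∞ 3 u (Ioo 0 T)) :
    MemLp (uncurry u) 3 (volume.restrict (Ioo 0 T ×ˢ (univ : Set ℝ³))) := by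
  obtain ⟨M, hM⟩ := h3.exists_ae_eLpNorm_le_of_top
  refine ⟨hm, ?_⟩
  have hm' : AEStronglyMeasurable (uncurry u) ((volume.restrict (Ioo 0 T)).prod (volume : Measure ℝ³)) := by
    rw [← volume_restrict_slab_eq_prod₃]; exact hm
  have h : ∫⁻ z in Ioo 0 T ×ˢ (univ : Set ℝ³), ‖uncurry u z‖ₑ ^ (3 : ℝ) < ⊤ := by
    rw [volume_restrict_slab_eq_prod₃, lintegral_prod _ (hm'.enorm.pow_const _)]
    calc ∫⁻ t in Ioo 0 T, ∫⁻ x, ‖uncurry u (t, x)‖ₑ ^ (3 : ℝ)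
        = ∫⁻ t in Ioo 0 T, eLpNorm (u t) 3 volume ^ (3 : ℝ) :=
          lintegral_congr fun t => lintegral_enorm_rpow_three_eq_eLpNorm_rpow _ (u t)
      _ ≤ ∫⁻ _ in Ioo 0 T, (M : ℝ≥0∞) ^ (3 : ℝ) :=
          lintegral_mono_ae (hM.mono fun t ht => ENNReal.rpow_le_rpow ht (by norm_num))
      _ < ⊤ := by
          rw [lintegral_const, Measure.restrict_apply_univ, Real.volume_Ioo]
          exact ENNReal.mul_lt_top (ENNReal.rpow_lt_top_of_nonneg (by norm_num) ENNReal.coe_ne_top)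
            ENNReal.ofReal_lt_top
  rw [lintegral_enorm_rpow_three_eq_eLpNorm_rpow] at h
  exact (ENNReal.rpow_lt_top_iff_of_pos (by norm_num)).1 h

end SlabClass

/-! ### The divergence constraint and the very weak momentum equation on the open slab -/

section VeryWeak

variable {T ν : ℝ} {f : ℝ → ℝ³ → ℝ³} {u₀ : ℝ³ → ℝ³} {u : ℝ → ℝ³ → ℝ³}

/-- A scalar space–time test function restricts, at every time, to a test function on the whole
space. [folklore] -/
theorem IsSpaceTimeTestOn.isTestFunctionOn_top_slice {Q : Opens (ℝ × ℝ³)} {F : Type*}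
    [NormedAddCommGroup F] [NormedSpace ℝ F] {θ : ℝ → ℝ³ → F} (hθ : IsSpaceTimeTestOn Q θ) (t : ℝ) :
    FunctionSpaces.IsTestFunctionOn (⊤ : Opens ℝ³) (θ t) where
  contDiff := hθ.contDiff_slice t
  hasCompactSupport := hθ.hasCompactSupport_slice t
  tsupport_subset := fun _ _ => trivial

/-- **The weak divergence constraint on the slab** for a weak solution: for every scalar test
function `θ ∈ C_c^∞((0,T) × ℝ³)`, `∫∫_{(0,T)×ℝ³} ⟪u, ∇ₓθ⟫ = 0` (the slices `u(t)` are weakly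
divergence free for a.e. `t`, `IsWeakNSSolutionOn`, and Fubini; this is the divergence conjunct of
`IsDistributionalNSSolutionOn`, Caffarelli–Kohn–Nirenberg 1982, (2.2)).
[cite: CaffarelliKohnNirenberg1982, §2 (2.2)] -/
theorem IsWeakNSSolutionOn.setIntegral_slab_inner_gradient_eq_zero (hw : IsWeakNSSolutionOn T ν f u₀ u)
    (hu1 : LocallyIntegrableOn (uncurry u)
      ((slab ℝ³ (Ioo 0 T) isOpen_Ioo : Opens (ℝ × ℝ³)) : Set (ℝ × ℝ³)) volume)
    {θ : ℝ → ℝ³ → ℝ} (hθ : IsSpaceTimeTestOn (slab ℝ³ (Ioo 0 T) isOpen_Ioo) θ) :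
    ∫ z in Ioo 0 T ×ˢ (univ : Set ℝ³), ⟪u z.1 z.2, gradient (θ z.1) z.2⟫ = 0 := by
  obtain ⟨hwc, -, hw0⟩ := hθ.continuous_gradient_field
  have hKQ : tsupport (uncurry θ) ⊆ ((slab ℝ³ (Ioo 0 T) isOpen_Ioo : Opens (ℝ × ℝ³)) : Set (ℝ × ℝ³)) :=
    hθ.tsupport_subset
  have hI : Integrable (fun z : ℝ × ℝ³ => ⟪u z.1 z.2, gradient (θ z.1) z.2⟫) (volume : Measure (ℝ × ℝ³)) :=
    integrable_inner_of_locallyIntegrableOn (Q := slab ℝ³ (Ioo 0 T) isOpen_Ioo)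
      hu1 hwc hθ.hasCompactSupport hKQ hw0
  -- the integrand vanishes off the slab: pass to the whole space–time and apply Fubini
  have hvan : ∀ z : ℝ × ℝ³, z ∉ Ioo 0 T ×ˢ (univ : Set ℝ³) → ⟪u z.1 z.2, gradient (θ z.1) z.2⟫ = 0 :=
    fun z hz => by rw [hw0 z fun h => hz (hKQ h), inner_zero_right]
  rw [setIntegral_eq_integral_of_forall_compl_eq_zero hvan, Measure.volume_eq_prod, integral_prod _ hI]
  -- a.e. slice integral vanishes
  have hdiv : ∀ᵐ t : ℝ, t ∈ Ioo 0 T → IsWeaklyDivFree (u t) :=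
    (ae_restrict_iff' measurableSet_Ioo).1 hw.ae_isWeaklyDivFree
  refine integral_eq_zero_of_ae ?_
  filter_upwards [hdiv] with t ht
  by_cases htI : t ∈ Ioo 0 T
  · exact ht htI (θ t) (hθ.isTestFunctionOn_top_slice t)
  · refine integral_eq_zero_of_ae (Eventually.of_forall fun x => ?_)
    have hz : ((t, x) : ℝ × ℝ³) ∉ tsupport (uncurry θ) := fun h => htI (mem_slab.1 (hKQ h))
    simp only [hw0 (t, x) hz, inner_zero_right, Pi.zero_apply]

/-- **The very weak momentum equation on the open slab** for a weak solution of the unforced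
system: for every test field `ψ ∈ C_c^∞((0,T) × ℝ³; ℝ³)` with divergence-free slices,
`∫∫_{(0,T)×ℝ³} (⟪u, ∂ₜψ⟫ + ⟪u, (u·∇)ψ⟫ + ν⟪u, Δψ⟫) = 0` (Leray's weak formulation
`IsWeakNSSolutionOn` tested with `ψ`, which is a test field on `(-∞, T) × ℝ³` vanishing at
`t = 0`, so that the datum term is absent; Fubini, the integrand being integrable for
`u, |u|² ∈ L¹_loc` of the slab). This is Lemarié-Rieusset's "very weak solution" property
(2016, Def. 6.2). [cite: LemarieRieusset2016, Def. 6.2 (file p. 126)] -/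
theorem IsWeakNSSolutionOn.setIntegral_slab_veryWeak_eq_zero (hw : IsWeakNSSolutionOn T ν 0 u₀ u)
    (hu1 : LocallyIntegrableOn (uncurry u)
      ((slab ℝ³ (Ioo 0 T) isOpen_Ioo : Opens (ℝ × ℝ³)) : Set (ℝ × ℝ³)) volume)
    (hu2 : LocallyIntegrableOn (fun z => ‖uncurry u z‖ ^ 2)
      ((slab ℝ³ (Ioo 0 T) isOpen_Ioo : Opens (ℝ × ℝ³)) : Set (ℝ × ℝ³)) volume)
    {ψ : ℝ → ℝ³ → ℝ³} (hψ : IsSpaceTimeTestOn (slab ℝ³ (Ioo 0 T) isOpen_Ioo) ψ)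
    (hdivψ : ∀ t, VectorCalculus.IsDivFree (ψ t)) :
    ∫ z in Ioo 0 T ×ˢ (univ : Set ℝ³), (⟪u z.1 z.2, timeDeriv ψ z.1 z.2⟫ +
      ⟪u z.1 z.2, convect (u z.1) (ψ z.1) z.2⟫ + ν * ⟪u z.1 z.2, Δ (ψ z.1) z.2⟫) = 0 := by
  -- the Leray weak formulation tested with `ψ`
  have hψ' : IsSpaceTimeTestOn (slab ℝ³ (Iio T) isOpen_Iio) ψ := hψ.mono (slab_mono Ioo_subset_Iio_self)
  have h := hw.2.2.2 ψ hψ' hdivψ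
  have hψ0 : ∀ x : ℝ³, ψ 0 x = 0 := fun x =>
    hψ.apply_eq_zero fun h0 => (lt_irrefl (0 : ℝ)) (mem_slab.1 h0).1
  simp only [Pi.zero_apply, inner_zero_left, add_zero, hψ0, inner_zero_right, integral_zero] at h
  -- Fubini
  obtain ⟨I1, I2, I3⟩ := integrable_veryWeak_terms hu1 hu2 hψ ν
  have hI : Integrable (fun z : ℝ × ℝ³ => ⟪u z.1 z.2, timeDeriv ψ z.1 z.2⟫ +
      ⟪u z.1 z.2, convect (u z.1) (ψ z.1) z.2⟫ + ν * ⟪u z.1 z.2, Δ (ψ z.1) z.2⟫)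
      ((volume.restrict (Ioo 0 T)).prod (volume : Measure ℝ³)) := by
    rw [← volume_restrict_slab_eq_prod₃]
    exact ((I1.add I2).add I3).restrict
  rw [volume_restrict_slab_eq_prod₃, integral_prod _ hI]
  exact h

end VeryWeak

/-! ### The space–time weak Poisson equation from the slice identities -/

section Poisson

variable {T : ℝ} {u : ℝ → ℝ³ → ℝ³} {p : ℝ → ℝ³ → ℝ}

/-- Second spatial derivatives of a space–time test function vanish off its support (operator
form; the tree's `fderiv_fderiv_slice_eq_zero_of_notMem_tsupport` of `CKNPressureDuality.lean` is
the applied form). [folklore] -/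
private theorem fderiv_fderiv_slice_eq_zero_of_notMem_tsupport' {F : Type*} [NormedAddCommGroup F]
    [NormedSpace ℝ F] {θ : ℝ → ℝ³ → F} {t : ℝ} {x : ℝ³} (h : (t, x) ∉ tsupport (uncurry θ)) :
    fderiv ℝ (fderiv ℝ (θ t)) x = 0 := by
  have hopen : IsOpen {y : ℝ³ | ((t, y) : ℝ × ℝ³) ∉ tsupport (uncurry θ)} :=
    (isClosed_tsupport _).isOpen_compl.preimage (continuous_const.prodMk continuous_id)
  have h1 : fderiv ℝ (θ t) =ᶠ[𝓝 x] fun _ => (0 : ℝ³ →L[ℝ] F) := by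
    filter_upwards [hopen.mem_nhds h] with y hy
    exact IsSpaceTimeTestOn.fderiv_slice_eq_zero_of_notMem hy
  rw [h1.fderiv_eq, fderiv_fun_const, Pi.zero_apply]

/-- The space–time Hessian field `z ↦ D²ₓθ(z)` of a space–time test function is continuous.
[folklore] -/
theorem IsSpaceTimeTestOn.continuous_hessian_field {Q : Opens (ℝ × ℝ³)} {θ : ℝ → ℝ³ → ℝ}
    (hθ : IsSpaceTimeTestOn Q θ) :
    Continuous fun z : ℝ × ℝ³ => fderiv ℝ (fderiv ℝ (θ z.1)) z.2 := by
  have h2 := ((hθ.isSmoothSpaceTimeOn univ).isSmoothSpaceTimeOn_fderiv_of_isOpen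
    isOpen_univ).isSmoothSpaceTimeOn_fderiv_of_isOpen isOpen_univ
  have hc := h2.continuousOn
  rw [univ_prod_univ, continuousOn_univ] at hc
  exact hc

-- nested operator types `ℝ³ →L[ℝ] ℝ³ →L[ℝ] ℝ`
set_option maxSynthPendingDepth 3 in
/-- **Integrability of the Hessian pairing `D²θ(u, u)` on space–time** for `|u|² ∈ L¹_loc` of an
open region containing the support of the test function. [folklore] -/
theorem integrable_hessian_apply_of_locallyIntegrableOn_sq {Q : Opens (ℝ × ℝ³)}
    (hu1 : LocallyIntegrableOn (uncurry u) (Q : Set (ℝ × ℝ³)) volume)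
    (hu2 : LocallyIntegrableOn (fun z => ‖uncurry u z‖ ^ 2) (Q : Set (ℝ × ℝ³)) volume)
    {θ : ℝ → ℝ³ → ℝ} (hθ : IsSpaceTimeTestOn Q θ) :
    Integrable (fun z : ℝ × ℝ³ => fderiv ℝ (fderiv ℝ (θ z.1)) z.2 (u z.1 z.2) (u z.1 z.2))
      (volume : Measure (ℝ × ℝ³)) := by
  set K : Set (ℝ × ℝ³) := tsupport (uncurry θ) with hK
  have hKc : IsCompact K := hθ.hasCompactSupport
  have hKQ : K ⊆ (Q : Set (ℝ × ℝ³)) := hθ.tsupport_subset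
  set Θ : ℝ × ℝ³ → ℝ³ →L[ℝ] ℝ³ →L[ℝ] ℝ := fun z => fderiv ℝ (fderiv ℝ (θ z.1)) z.2 with hΘ
  have hΘc : Continuous Θ := hθ.continuous_hessian_field
  have hΘ0 : ∀ z ∉ K, Θ z = 0 := fun z hz =>
    fderiv_fderiv_slice_eq_zero_of_notMem_tsupport' (t := z.1) (x := z.2) hz
  obtain ⟨M, hM⟩ := hΘc.bounded_above_of_compact_support (HasCompactSupport.intro hKc hΘ0)
  have huK : IntegrableOn (uncurry u) K volume := hu1.integrableOn_compact_subset hKQ hKc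
  have hu2K : IntegrableOn (fun z => ‖uncurry u z‖ ^ 2) K volume :=
    hu2.integrableOn_compact_subset hKQ hKc
  have hmeas : AEStronglyMeasurable (fun z : ℝ × ℝ³ => Θ z (u z.1 z.2) (u z.1 z.2))
      (volume.restrict K) := by
    have hv : AEStronglyMeasurable (fun z : ℝ × ℝ³ => u z.1 z.2) (volume.restrict K) :=
      huK.aestronglyMeasurable
    have h1 : AEStronglyMeasurable (fun z => Θ z (u z.1 z.2)) (volume.restrict K) :=
      isBoundedBilinearMap_apply.continuous.comp_aestronglyMeasurable
        (hΘc.aestronglyMeasurable.prodMk hv)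
    exact isBoundedBilinearMap_apply.continuous.comp_aestronglyMeasurable (h1.prodMk hv)
  have h1 : IntegrableOn (fun z : ℝ × ℝ³ => Θ z (u z.1 z.2) (u z.1 z.2)) K volume := by
    refine Integrable.mono' (hu2K.const_mul M) hmeas ?_
    filter_upwards with z
    calc ‖Θ z (u z.1 z.2) (u z.1 z.2)‖ ≤ ‖Θ z‖ * ‖u z.1 z.2‖ * ‖u z.1 z.2‖ := (Θ z).le_opNorm₂ _ _
      _ = ‖Θ z‖ * ‖uncurry u z‖ ^ 2 := by simp only [uncurry]; ring
      _ ≤ M * ‖uncurry u z‖ ^ 2 := mul_le_mul_of_nonneg_right (hM z) (sq_nonneg _)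
  exact h1.integrable_of_forall_notMem_eq_zero fun z hz => by
    simp only [hΘ0 z hz, zero_apply]

-- nested operator types `ℝ³ →L[ℝ] ℝ³ →L[ℝ] ℝ`
set_option maxSynthPendingDepth 3 in
/-- **The weak pressure Poisson equation on space–time from its time slices.** If `u, |u|², p`
are locally integrable on the open slab `(0,T) × ℝ³` and for a.e. `t ∈ (0,T)` the slice identity
`∫ p(t) Δφ = -∫ D²φ(u(t), u(t))` holds for every test function `φ ∈ C_c^∞(ℝ³)` (i.e. `p(t)` is the
Riesz pressure of `u(t) ⊗ u(t)`), then for every space–time test function `θ` on the slab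
`∫∫ p Δₓθ = -∫∫ D²ₓθ(u, u)` (test slice-wise with `φ = θ(t, ·)` and integrate in `t`: Fubini on
both sides). [cite: LemarieRieusset2016, Prop. 6.5 with Def. 6.9 (file p. 136)] -/
theorem setIntegral_slab_pressure_mul_laplacian_eq_of_slices
    (hu1 : LocallyIntegrableOn (uncurry u)
      ((slab ℝ³ (Ioo 0 T) isOpen_Ioo : Opens (ℝ × ℝ³)) : Set (ℝ × ℝ³)) volume)
    (hu2 : LocallyIntegrableOn (fun z => ‖uncurry u z‖ ^ 2)
      ((slab ℝ³ (Ioo 0 T) isOpen_Ioo : Opens (ℝ × ℝ³)) : Set (ℝ × ℝ³)) volume)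
    (hp1 : LocallyIntegrableOn (uncurry p)
      ((slab ℝ³ (Ioo 0 T) isOpen_Ioo : Opens (ℝ × ℝ³)) : Set (ℝ × ℝ³)) volume)
    (hsl : ∀ᵐ t ∂(volume.restrict (Ioo 0 T)), ∀ φ : ℝ³ → ℝ, ContDiff ℝ (⊤ : ℕ∞) φ →
      HasCompactSupport φ → ∫ x, p t x * (Δ φ) x = -∫ x, fderiv ℝ (fderiv ℝ φ) x (u t x) (u t x))
    {θ : ℝ → ℝ³ → ℝ} (hθ : IsSpaceTimeTestOn (slab ℝ³ (Ioo 0 T) isOpen_Ioo) θ) :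
    ∫ z in Ioo 0 T ×ˢ (univ : Set ℝ³), p z.1 z.2 * Δ (θ z.1) z.2 =
      -∫ z in Ioo 0 T ×ˢ (univ : Set ℝ³), fderiv ℝ (fderiv ℝ (θ z.1)) z.2 (u z.1 z.2) (u z.1 z.2) := by
  set K : Set (ℝ × ℝ³) := tsupport (uncurry θ) with hK
  have hKc : IsCompact K := hθ.hasCompactSupport
  have hKQ : K ⊆ ((slab ℝ³ (Ioo 0 T) isOpen_Ioo : Opens (ℝ × ℝ³)) : Set (ℝ × ℝ³)) := hθ.tsupport_subset
  -- integrability of the two integrands on the whole space–time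
  have hΛ := hθ.laplacian_isSpaceTimeTestOn
  have hΛc : Continuous fun z : ℝ × ℝ³ => Δ (θ z.1) z.2 := hΛ.contDiff.continuous
  have hΛ0 : ∀ z ∉ K, Δ (θ z.1) z.2 = 0 := fun z hz =>
    laplacian_slice_eq_zero_of_notMem_tsupport (t := z.1) (x := z.2) hz
  have IP : Integrable (fun z : ℝ × ℝ³ => p z.1 z.2 * Δ (θ z.1) z.2) (volume : Measure (ℝ × ℝ³)) :=
    integrable_mul_of_locallyIntegrableOn (F := uncurry p) hp1 hΛc hKc hKQ hΛ0
  have IH := integrable_hessian_apply_of_locallyIntegrableOn_sq hu1 hu2 hθ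
  -- both integrands vanish off the slab: pass to the whole space–time and apply Fubini
  have hvanP : ∀ z : ℝ × ℝ³, z ∉ Ioo 0 T ×ˢ (univ : Set ℝ³) → p z.1 z.2 * Δ (θ z.1) z.2 = 0 :=
    fun z hz => by rw [hΛ0 z fun h => hz (hKQ h), mul_zero]
  have hvanH : ∀ z : ℝ × ℝ³, z ∉ Ioo 0 T ×ˢ (univ : Set ℝ³) →
      fderiv ℝ (fderiv ℝ (θ z.1)) z.2 (u z.1 z.2) (u z.1 z.2) = 0 := fun z hz => by
    rw [fderiv_fderiv_slice_eq_zero_of_notMem_tsupport' (t := z.1) (x := z.2) fun h => hz (hKQ h),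
      zero_apply, zero_apply]
  rw [setIntegral_eq_integral_of_forall_compl_eq_zero hvanP,
    setIntegral_eq_integral_of_forall_compl_eq_zero hvanH, Measure.volume_eq_prod,
    integral_prod _ IP, integral_prod _ IH, ← integral_neg]
  -- the slice identities
  have hsl' : ∀ᵐ t : ℝ, t ∈ Ioo 0 T → ∀ φ : ℝ³ → ℝ, ContDiff ℝ (⊤ : ℕ∞) φ →
      HasCompactSupport φ → ∫ x, p t x * (Δ φ) x = -∫ x, fderiv ℝ (fderiv ℝ φ) x (u t x) (u t x) :=
    (ae_restrict_iff' measurableSet_Ioo).1 hsl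
  refine integral_congr_ae ?_
  filter_upwards [hsl'] with t ht
  by_cases htI : t ∈ Ioo 0 T
  · exact ht htI (θ t) (hθ.contDiff_slice t) (hθ.hasCompactSupport_slice t)
  · -- off `(0, T)` both slice integrands vanish identically
    have hz : ∀ x : ℝ³, ((t, x) : ℝ × ℝ³) ∉ K := fun x h => htI (mem_slab.1 (hKQ h))
    have e1 : ∀ x : ℝ³, p t x * Δ (θ t) x = 0 := fun x => by
      rw [laplacian_slice_eq_zero_of_notMem_tsupport (hz x), mul_zero]
    have e2 : ∀ x : ℝ³, fderiv ℝ (fderiv ℝ (θ t)) x (u t x) (u t x) = 0 := fun x => by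
      rw [fderiv_fderiv_slice_eq_zero_of_notMem_tsupport' (hz x), zero_apply,
        zero_apply]
    simp only [e1, e2, integral_zero, neg_zero]

end Poisson

/-! ### The discharge -/

section Main

/-- `1 ≤ 3/2` in `ℝ≥0∞`. [folklore] -/
private theorem one_le_threeHalves' : (1 : ℝ≥0∞) ≤ 3 / 2 := by
  rw [ENNReal.le_div_iff_mul_le (Or.inl two_ne_zero) (Or.inl ENNReal.ofNat_ne_top)]; norm_num

/-- **The guarded mixed class `L^∞(S; L^{3/2})` from a.e. slice bounds**: if for a.e. `t ∈ S` the
slice `p(t)` lies in `L^{3/2}` with `‖p(t)‖_{3/2} ≤ C < ∞`, then `p ∈ L^∞(S; L^{3/2})` in the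
sense of `MemLqLp ∞ (3/2) p S`. [folklore] -/
theorem memLqLp_top_of_ae_slice_bound {X : Type*} [MeasureSpace X] {p : ℝ → X → ℝ} {q C : ℝ≥0∞}
    (hC : C ≠ ⊤) {S : Set ℝ}
    (h : ∀ᵐ t ∂(volume.restrict S), MemLp (p t) q volume ∧ eLpNorm (p t) q volume ≤ C) :
    MemLqLp ∞ q p S := by
  refine ⟨h.mono fun t ht => ht.1, ?_⟩
  rw [eLqLpNorm_def, eLpNorm_exponent_top]
  refine eLpNormEssSup_lt_top_of_ae_bound (C := C.toReal) ?_
  filter_upwards [h] with t ht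
  rw [Real.norm_eq_abs, abs_of_nonneg ENNReal.toReal_nonneg]
  exact ENNReal.toReal_mono hC ht.2

/-- **Discharge of `ess_associated_pressure`** (Escauriaza–Seregin–Šverák 2003, §3, proof of
Thm. 1.3, (3.2)–(3.4): the associated pressure of an `L_{3,∞}` Leray–Hopf solution, with
`p ∈ L_{3/2,∞}(Q_T)` and the Navier–Stokes equations in the sense of distributions on `Q_T`).
Let `ν > 0`, `T > 0`, `u₀ ∈ L²` weakly divergence free, `u` a Leray–Hopf weak solution of the
unforced Cauchy problem on `ℝ³ × [0,T)` with datum `u₀` and `u ∈ L^∞(0,T; L³)`. Put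
`p(t) = Π[u(t)] = Σᵢⱼ ℛᵢℛⱼ(uᵢuⱼ)(t)`, realised as a jointly measurable function on the slab
(`exists_spaceTime_rieszPressure_of_memLp`; here `u ∈ L³((0,T) × ℝ³)` by
`memLp_uncurry_slab_of_memLqLp_top`). Then: (3.4) `p ∈ L^∞(0,T; L^{3/2})` by Stein's bound
`‖p(t)‖_{3/2} ≤ C_{3/2}‖u(t)‖₃² ≤ C_{3/2} M²` for a.e. `t` (`memLqLp_top_of_ae_slice_bound`); and
`(u, p)` is a distributional solution on the open slab `(0,T) × ℝ³` by
`isDistributionalNSSolutionOn_slab_of_veryWeak`, whose three hypotheses are the sliced divergence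
constraint (`IsWeakNSSolutionOn.setIntegral_slab_inner_gradient_eq_zero`), the pressure equation
(3.3) in weak form (`setIntegral_slab_pressure_mul_laplacian_eq_of_slices`, from the slice Poisson
identities of `Π`) and the very weak momentum equation
(`IsWeakNSSolutionOn.setIntegral_slab_veryWeak_eq_zero`, Leray's weak formulation tested on the
open slab). The hypotheses `ν > 0`, `u₀ ∈ L²`, `div u₀ = 0` of the fact are not needed beyond the
Leray–Hopf class. [cite: EscauriazaSereginSverak2003, §3, proof of Thm. 1.3, (3.2)–(3.4)]
[cite: LemarieRieusset2016, Prop. 6.5 with Def. 6.9 (file p. 136)] -/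
theorem ess_associated_pressure_holds : ess_associated_pressure := by
  intro ν T _hν hT u₀ u _hu₀ _hdiv hLH h₃
  -- §1 the velocity class on the slab
  have hw : IsWeakNSSolutionOn T ν 0 u₀ u := hLH.weak
  have hm : AEStronglyMeasurable (uncurry u) (volume.restrict (Ioo 0 T ×ˢ (univ : Set ℝ³))) := hw.1
  have hu3 : MemLp (uncurry u) 3 (volume.restrict (Ioo 0 T ×ˢ (univ : Set ℝ³))) :=
    memLp_uncurry_slab_of_memLqLp_top hm h₃
  have hu1 : LocallyIntegrableOn (uncurry u)
      ((slab ℝ³ (Ioo 0 T) isOpen_Ioo : Opens (ℝ × ℝ³)) : Set (ℝ × ℝ³)) volume :=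
    locallyIntegrableOn_slab_of_memLp hu3 (by norm_num)
  have hu2 : LocallyIntegrableOn (fun z => ‖uncurry u z‖ ^ 2)
      ((slab ℝ³ (Ioo 0 T) isOpen_Ioo : Opens (ℝ × ℝ³)) : Set (ℝ × ℝ³)) volume :=
    locallyIntegrableOn_slab_of_memLp (memLp_norm_sq_of_memLp_three hu3) one_le_threeHalves'
  -- §2 the pressure `p(t) = Π[u(t)]`, jointly measurable on the slab
  obtain ⟨p, -, hp32, hsl⟩ := exists_spaceTime_rieszPressure_of_memLp hT hu3
  have hp1 : LocallyIntegrableOn (uncurry p)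
      ((slab ℝ³ (Ioo 0 T) isOpen_Ioo : Opens (ℝ × ℝ³)) : Set (ℝ × ℝ³)) volume :=
    locallyIntegrableOn_slab_of_memLp hp32 one_le_threeHalves'
  obtain ⟨M, hM⟩ := h₃.exists_ae_eLpNorm_le_of_top
  refine ⟨p, ?_, ?_⟩
  · -- (3.4): `p ∈ L^∞(0,T; L^{3/2})`
    refine memLqLp_top_of_ae_slice_bound (C := steinConstThreeHalves * (M : ℝ≥0∞) ^ 2)
      (ENNReal.mul_ne_top ENNReal.coe_ne_top (ENNReal.pow_ne_top ENNReal.coe_ne_top)) ?_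
    filter_upwards [hsl, hM] with t ht htM
    obtain ⟨-, -, hpt, hle, -⟩ := ht
    exact ⟨hpt, hle.trans (by gcongr)⟩
  · -- (3.2)–(3.3): the Navier–Stokes equations in the sense of distributions on `Q_T`
    exact isDistributionalNSSolutionOn_slab_of_veryWeak hu3 hp32
      (fun θ hθ => hw.setIntegral_slab_inner_gradient_eq_zero hu1 hθ)
      (fun θ hθ => setIntegral_slab_pressure_mul_laplacian_eq_of_slices hu1 hu2 hp1
        (hsl.mono fun t ht => ht.2.2.2.2) hθ)
      (fun ψ hψ hdivψ => hw.setIntegral_slab_veryWeak_eq_zero hu1 hu2 hψ hdivψ)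

end Main

end Literature.Analysis.FluidPDE
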